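import Summits.NavierStokesRegularity.NavierStokesRegularity.Theses.AxisymmetricExtremality
import Literature.Analysis.FluidPDE.Seregin2020AncientLimitSymmetry
import Literature.Analysis.FluidPDE.SereginZajaczkowski2007SwirlRotation
import HarnessLib

/-!
# Seregin 2020, Thm 2.1, property (𝒜)(ii): almost-everywhere axisymmetric fields have
# pointwise axisymmetric representatives (averaging over the rotation group)

Helper toward the stub `stub_seregin2020TypeII` of the crux `AxisymmetricKatoGlobal`
(= the named fact `Literature.Analysis.FluidPDE.Seregin2020_axisymmetricSingularPoint_typeII`,
G. Seregin, Anal. Math. Phys. 10 (2020) Paper 46 = arXiv:2006.04140, Thm 2.1). The tree's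
blow-up limit at an axisymmetric Type I singular point
(`Literature.Analysis.FluidPDE.Seregin2020.exists_ancientLimit_axisymmetric`) is axisymmetric only
almost everywhere — "for every rotation `R_θ`, `w(s, R_θ y) = R_θ w(s, y)` for a.e. `(s, y)`" —
whereas every axisymmetric tool of the tree consumed by the later steps of the printed proof
(structure of the singular set `Seregin2020.offAxis_regular`, `singularSet_subset_axis`, the
swirl files, `IsAxisymmetric`, `IsAxisymmetricScalar`) is stated for POINTWISE symmetric slices.
The docstring of `Seregin2020AncientLimitSymmetry.lean` records the gap: "A pointwise
axisymmetric representative … can then be obtained by averaging over the rotation group; not done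
here." This file does it, once and for all, for a general "twist" `A θ` by linear isometries
(vector fields: `A θ = R_{-θ}`; scalars: `A θ = id`):

* `exists_repr_of_ae_twistInvariant` — if `f : ℝ × ℝ³ → E` is measurable and
  `A θ (f (s, R_θ y)) = f (s, y)` for `μ`-a.e. `(s, y)`, for every `θ`, then the rotation average
  `g (s, y) = (2π)⁻¹ ∫₀^{2π} A θ (f (s, R_θ y)) dθ` satisfies the identity EVERYWHERE and `g = f`
  `μ`-a.e. (Fubini swap of the a.e. quantifiers, `Measure.ae_ae_comm`);
* `exists_repr_of_ae_twistInvariant_of_aestronglyMeasurable` — the same for `μ`-a.e. strongly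
  measurable `f` when `μ` is invariant under the space–time rotations;
* `exists_isAxisymmetric_repr`, `exists_isAxisymmetricScalar_repr` — the two cases on the
  half-space `{s < 0} = ⋃ₙ Q(n + 1)`, in the per-`Q(a)` form delivered by
  `Seregin2020.exists_ancientLimit_axisymmetric`.

## References

* G. Seregin, Anal. Math. Phys. 10 (2020), Paper 46 = arXiv:2006.04140, proof of Thm. 2.1,
  property (𝒜)(ii). [Seregin2020]
-/

-- the problem directory repeats the summit name (D-0017); core's `dupNamespace` linter fires
set_option linter.dupNamespace false

noncomputable section

open MeasureTheory Set Function Filter Topology TopologicalSpace Metric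
open scoped NNReal ENNReal

namespace Summit.NavierStokesRegularity.NavierStokesRegularity.Theorems.AxisymmetricKatoGlobal.EulerScaling

open Literature.Analysis.FluidPDE Literature.Analysis.FluidPDE.Seregin2020

/-! ### The space–time rotation as a function of the angle -/

/-- The space–time rotation `(s, y) ↦ (s, R_θ y)` as a function of `((s, y), θ)` is continuous
(from the tree's joint continuity `SereginZajaczkowski2007.continuous_rotZ_prod`). [folklore] -/
theorem continuous_rotST_uncurry :
    Continuous fun q : (ℝ × EuclideanSpace ℝ (Fin 3)) × ℝ => (q.1.1, rotZ q.2 q.1.2) :=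
  continuous_fst.fst.prodMk
    (SereginZajaczkowski2007.continuous_rotZ_prod.comp₂ continuous_snd continuous_fst.snd)

/-! ### The rotation average -/

section Twist

variable {E : Type*} [NormedAddCommGroup E] [NormedSpace ℝ E] [CompleteSpace E]
  [SecondCountableTopology E] [MeasurableSpace E] [BorelSpace E]

/-- **A.e. twisted rotation invariance has an exactly invariant representative.** Let
`A θ : E →ₗᵢ E` be a continuous one-parameter family of linear isometries with
`A (θ + α) = A α ∘ A θ` and `A (θ + 2π) = A θ`, let `f : ℝ × ℝ³ → E` be measurable, and suppose
that for every angle `θ`, `A θ (f (s, R_θ y)) = f (s, y)` for `μ`-a.e. `(s, y)` (`μ` any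
s-finite measure on `ℝ × ℝ³`). Then there is `g` with `A θ (g (s, R_θ y)) = g (s, y)` for ALL
`θ, s, y` and `g = f` `μ`-a.e.: `g` is the average `(2π)⁻¹ ∫₀^{2π} A θ (f (s, R_θ y)) dθ`, which is
exactly invariant by the translation invariance of the integral over a period, and agrees with `f`
wherever `θ ↦ A θ (f (s, R_θ y))` is a.e. constant — which, by Fubini (`Measure.ae_ae_comm`), is
the case for `μ`-a.e. `(s, y)`. [folklore] -/
theorem exists_repr_of_ae_twistInvariant (A : ℝ → E →ₗᵢ[ℝ] E)
    (hA : ∀ θ α (v : E), A (θ + α) v = A α (A θ v))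
    (hAper : ∀ θ (v : E), A (θ + 2 * Real.pi) v = A θ v)
    (hAc : Continuous fun p : ℝ × E => A p.1 p.2)
    {μ : Measure (ℝ × EuclideanSpace ℝ (Fin 3))} [SFinite μ]
    {f : ℝ × EuclideanSpace ℝ (Fin 3) → E} (hf : Measurable f)
    (hsym : ∀ θ, ∀ᵐ z ∂μ, A θ (f (z.1, rotZ θ z.2)) = f z) :
    ∃ g : ℝ × EuclideanSpace ℝ (Fin 3) → E,
      (∀ θ z, A θ (g (z.1, rotZ θ z.2)) = g z) ∧ g =ᵐ[μ] f := by
  -- the integrand of the average and the average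
  set F : (ℝ × EuclideanSpace ℝ (Fin 3)) → ℝ → E := fun z θ => A θ (f (z.1, rotZ θ z.2)) with hF
  set g : ℝ × EuclideanSpace ℝ (Fin 3) → E :=
    fun z => (2 * Real.pi)⁻¹ • ∫ θ in (0 : ℝ)..2 * Real.pi, F z θ with hg
  have h2π : (0 : ℝ) < 2 * Real.pi := Real.two_pi_pos
  -- periodicity of the integrand in the angle
  have hper : ∀ z, Function.Periodic (F z) (2 * Real.pi) := fun z θ => by
    simp only [hF, hAper]
    rw [add_comm θ, rotZ_add, SereginZajaczkowski2007.rotZ_two_pi]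
  refine ⟨g, fun α z => ?_, ?_⟩
  · -- ### exact invariance
    have hshift : ∀ θ, A α (F (z.1, rotZ α z.2) θ) = F z (θ + α) := fun θ => by
      simp only [hF, ← rotZ_add, hA]
    calc A α (g (z.1, rotZ α z.2))
        = (2 * Real.pi)⁻¹ • A α (∫ θ in (0 : ℝ)..2 * Real.pi, F (z.1, rotZ α z.2) θ) := by
          rw [hg, (A α).map_smul]
      _ = (2 * Real.pi)⁻¹ • ∫ θ in (0 : ℝ)..2 * Real.pi, A α (F (z.1, rotZ α z.2) θ) := by
          congr 1
          simp only [intervalIntegral, map_sub, (A α).integral_comp_comm]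
      _ = (2 * Real.pi)⁻¹ • ∫ θ in (0 : ℝ)..2 * Real.pi, F z (θ + α) := by
          simp only [hshift]
      _ = (2 * Real.pi)⁻¹ • ∫ θ in α..α + 2 * Real.pi, F z θ := by
          rw [intervalIntegral.integral_comp_add_right, zero_add, add_comm]
      _ = (2 * Real.pi)⁻¹ • ∫ θ in (0 : ℝ)..0 + 2 * Real.pi, F z θ := by
          rw [(hper z).intervalIntegral_add_eq α 0]
      _ = g z := by rw [zero_add]
  · -- ### a.e. agreement: Fubini swap of the a.e. quantifiers
    have hFm : Measurable fun q : (ℝ × EuclideanSpace ℝ (Fin 3)) × ℝ => F q.1 q.2 := by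
      have h1 : Measurable fun q : (ℝ × EuclideanSpace ℝ (Fin 3)) × ℝ => f (q.1.1, rotZ q.2 q.1.2) :=
        hf.comp continuous_rotST_uncurry.measurable
      exact hAc.measurable.comp (measurable_snd.prodMk h1)
    have hmeas : MeasurableSet {q : (ℝ × EuclideanSpace ℝ (Fin 3)) × ℝ | F q.1 q.2 = f q.1} :=
      measurableSet_eq_fun hFm (hf.comp measurable_fst)
    have h1 : ∀ᵐ θ ∂(volume : Measure ℝ), ∀ᵐ z ∂μ, F z θ = f z := ae_of_all _ hsym
    have h2 : ∀ᵐ z ∂μ, ∀ᵐ θ ∂(volume : Measure ℝ), F z θ = f z :=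
      (Measure.ae_ae_comm hmeas).2 h1
    filter_upwards [h2] with z hz
    have hint : ∫ θ in (0 : ℝ)..2 * Real.pi, F z θ = ∫ θ in (0 : ℝ)..2 * Real.pi, f z := by
      refine intervalIntegral.integral_congr_ae ?_
      filter_upwards [hz] with θ hθ _ using hθ
    rw [hg]
    simp only
    rw [hint, intervalIntegral.integral_const, sub_zero, smul_smul, inv_mul_cancel₀ h2π.ne', one_smul]

/-- The same for a `μ`-a.e. strongly measurable `f`, when `μ` is invariant under every space–time
rotation `(s, y) ↦ (s, R_θ y)` (so that the a.e. hypothesis transfers to a measurable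
modification of `f`). [folklore] -/
theorem exists_repr_of_ae_twistInvariant_of_aestronglyMeasurable (A : ℝ → E →ₗᵢ[ℝ] E)
    (hA : ∀ θ α (v : E), A (θ + α) v = A α (A θ v))
    (hAper : ∀ θ (v : E), A (θ + 2 * Real.pi) v = A θ v)
    (hAc : Continuous fun p : ℝ × E => A p.1 p.2)
    {μ : Measure (ℝ × EuclideanSpace ℝ (Fin 3))} [SFinite μ]
    (hμ : ∀ θ, MeasurePreserving (fun z : ℝ × EuclideanSpace ℝ (Fin 3) => (z.1, rotZ θ z.2)) μ μ)
    {f : ℝ × EuclideanSpace ℝ (Fin 3) → E} (hf : AEStronglyMeasurable f μ)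
    (hsym : ∀ θ, ∀ᵐ z ∂μ, A θ (f (z.1, rotZ θ z.2)) = f z) :
    ∃ g : ℝ × EuclideanSpace ℝ (Fin 3) → E,
      (∀ θ z, A θ (g (z.1, rotZ θ z.2)) = g z) ∧ g =ᵐ[μ] f := by
  have hfW : f =ᵐ[μ] hf.mk f := hf.ae_eq_mk
  have hsymW : ∀ θ, ∀ᵐ z ∂μ, A θ (hf.mk f (z.1, rotZ θ z.2)) = hf.mk f z := fun θ => by
    have hcomp : ∀ᵐ z ∂μ, f (z.1, rotZ θ z.2) = hf.mk f (z.1, rotZ θ z.2) :=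
      (hμ θ).quasiMeasurePreserving.ae_eq_comp hfW
    filter_upwards [hsym θ, hcomp, hfW] with z h1 h2 h3
    rw [← h2, h1, h3]
  obtain ⟨g, hg, hgW⟩ := exists_repr_of_ae_twistInvariant A hA hAper hAc
    hf.stronglyMeasurable_mk.measurable hsymW
  exact ⟨g, hg, hgW.trans hfW.symm⟩

end Twist

/-! ### The half-space `{s < 0}` and the cylinders `Q(a)` -/

/-- The open lower half-space `{(s, y) : s < 0}` is the increasing union of the parabolic balls
`Q(n + 1) = ]-(n+1)², 0[ × B(0, n + 1)`. [folklore] -/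
theorem iUnion_parabolicCylinder_nat :
    (⋃ n : ℕ, parabolicCylinder ((n : ℝ) + 1) (0 : ℝ × EuclideanSpace ℝ (Fin 3))) =
      {z | z.1 < 0} := by
  ext z
  simp only [mem_iUnion, mem_parabolicCylinder, Prod.fst_zero, Prod.snd_zero, zero_sub,
    dist_zero_right, mem_setOf_eq]
  constructor
  · rintro ⟨n, ⟨-, h⟩, -⟩
    exact h
  · intro hz
    refine ⟨⌈-z.1 + ‖z.2‖⌉₊, ⟨?_, hz⟩, ?_⟩
    · have h1 : -z.1 + ‖z.2‖ ≤ ⌈-z.1 + ‖z.2‖⌉₊ := Nat.le_ceil _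
      have h2 : (1 : ℝ) ≤ (⌈-z.1 + ‖z.2‖⌉₊ : ℝ) + 1 := by
        have : (0 : ℝ) ≤ (⌈-z.1 + ‖z.2‖⌉₊ : ℝ) := Nat.cast_nonneg _
        linarith
      nlinarith [norm_nonneg z.2]
    · have h1 : -z.1 + ‖z.2‖ ≤ ⌈-z.1 + ‖z.2‖⌉₊ := Nat.le_ceil _
      linarith

/-- The lower half-space is measurable. [folklore] -/
theorem measurableSet_halfSpace :
    MeasurableSet {z : ℝ × EuclideanSpace ℝ (Fin 3) | z.1 < 0} :=
  measurableSet_lt measurable_fst measurable_const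

/-- The space–time rotations preserve Lebesgue measure restricted to the lower half-space.
[folklore] -/
theorem measurePreserving_rotST_halfSpace (θ : ℝ) :
    MeasurePreserving (fun z : ℝ × EuclideanSpace ℝ (Fin 3) => (z.1, rotZ θ z.2))
      (volume.restrict {z : ℝ × EuclideanSpace ℝ (Fin 3) | z.1 < 0})
      (volume.restrict {z : ℝ × EuclideanSpace ℝ (Fin 3) | z.1 < 0}) := by
  have h := (measurePreserving_rotST θ).restrict_preimage measurableSet_halfSpace
  exact h

/-- A.e. on every `Q(a)`, `a > 0`, is a.e. on the lower half-space. [folklore] -/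
theorem ae_restrict_halfSpace_of_forall {p : ℝ × EuclideanSpace ℝ (Fin 3) → Prop}
    (h : ∀ a : ℝ, 0 < a → ∀ᵐ z ∂(volume.restrict (parabolicCylinder a (0 : ℝ × EuclideanSpace ℝ (Fin 3)))), p z) :
    ∀ᵐ z ∂(volume.restrict {z : ℝ × EuclideanSpace ℝ (Fin 3) | z.1 < 0}), p z := by
  rw [← iUnion_parabolicCylinder_nat, ae_restrict_iUnion_iff]
  exact fun n => h _ (by positivity)

/-- A.e. on the lower half-space is a.e. on every `Q(a)`. [folklore] -/
theorem ae_restrict_parabolicCylinder_of_halfSpace {p : ℝ × EuclideanSpace ℝ (Fin 3) → Prop}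
    (h : ∀ᵐ z ∂(volume.restrict {z : ℝ × EuclideanSpace ℝ (Fin 3) | z.1 < 0}), p z) (a : ℝ) :
    ∀ᵐ z ∂(volume.restrict (parabolicCylinder a (0 : ℝ × EuclideanSpace ℝ (Fin 3)))), p z := by
  refine ae_restrict_of_ae_restrict_of_subset (fun z hz => ?_) h
  rw [mem_parabolicCylinder] at hz
  simpa using hz.1.2

/-- A.e. strong measurability on every `Q(a)`, `a > 0`, is a.e. strong measurability on the lower
half-space. [folklore] -/
theorem aestronglyMeasurable_halfSpace_of_forall {E : Type*} [TopologicalSpace E]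
    [PseudoMetrizableSpace E] {f : ℝ × EuclideanSpace ℝ (Fin 3) → E}
    (h : ∀ a : ℝ, 0 < a → AEStronglyMeasurable f (volume.restrict (parabolicCylinder a (0 : ℝ × EuclideanSpace ℝ (Fin 3))))) :
    AEStronglyMeasurable f (volume.restrict {z : ℝ × EuclideanSpace ℝ (Fin 3) | z.1 < 0}) := by
  rw [← iUnion_parabolicCylinder_nat, aestronglyMeasurable_iUnion_iff]
  exact fun n => h _ (by positivity)

/-! ### Vector fields and scalars -/

/-- **Pointwise axisymmetric representative of an a.e. axisymmetric vector field** (Seregin 2020,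
property (𝒜)(ii) of the blow-up limit, pointwise form). If `w : ℝ → ℝ³ → ℝ³` is a.e. strongly
measurable on every `Q(a)` and for every rotation `R_θ` and every `a > 0`,
`w(s, R_θ y) = R_θ w(s, y)` for a.e. `(s, y) ∈ Q(a)`, then there is `w'` with EVERY slice `w' s`
axisymmetric (`IsAxisymmetric`) and `w' = w` a.e. on every `Q(a)`.
[cite: Seregin2020, proof of Thm 2.1, property (𝒜)(ii)] -/
theorem exists_isAxisymmetric_repr
    {w : ℝ → EuclideanSpace ℝ (Fin 3) → EuclideanSpace ℝ (Fin 3)}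
    (hw : ∀ a : ℝ, 0 < a → AEStronglyMeasurable (uncurry w)
      (volume.restrict (parabolicCylinder a (0 : ℝ × EuclideanSpace ℝ (Fin 3)))))
    (hsym : ∀ (θ a : ℝ), 0 < a →
      ∀ᵐ z ∂(volume.restrict (parabolicCylinder a (0 : ℝ × EuclideanSpace ℝ (Fin 3)))),
        w z.1 (rotZ θ z.2) = rotZ θ (w z.1 z.2)) :
    ∃ w' : ℝ → EuclideanSpace ℝ (Fin 3) → EuclideanSpace ℝ (Fin 3),
      (∀ s, IsAxisymmetric (w' s)) ∧
      ∀ a : ℝ, 0 < a →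
        ∀ᵐ z ∂(volume.restrict (parabolicCylinder a (0 : ℝ × EuclideanSpace ℝ (Fin 3)))),
          uncurry w' z = uncurry w z := by
  -- the twist `A θ = R_{-θ}`
  set A : ℝ → EuclideanSpace ℝ (Fin 3) →ₗᵢ[ℝ] EuclideanSpace ℝ (Fin 3) :=
    fun θ => (rotZLIE (-θ)).toLinearIsometry with hAdef
  have hAapp : ∀ θ v, A θ v = rotZ (-θ) v := fun θ v => rfl
  have hA : ∀ θ α (v : EuclideanSpace ℝ (Fin 3)), A (θ + α) v = A α (A θ v) := fun θ α v => by
    rw [hAapp, hAapp, hAapp, ← rotZ_add, neg_add_rev]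
  have hAper : ∀ θ (v : EuclideanSpace ℝ (Fin 3)), A (θ + 2 * Real.pi) v = A θ v := fun θ v => by
    have h := SereginZajaczkowski2007.rotZ_two_pi (rotZ (-θ - 2 * Real.pi) v)
    rw [← rotZ_add, show 2 * Real.pi + (-θ - 2 * Real.pi) = -θ by ring] at h
    rw [hAapp, hAapp, show -(θ + 2 * Real.pi) = -θ - 2 * Real.pi by ring, h]
  have hAc : Continuous fun p : ℝ × EuclideanSpace ℝ (Fin 3) => A p.1 p.2 := by
    simp only [hAapp]
    exact SereginZajaczkowski2007.continuous_rotZ_prod.comp₂ continuous_fst.neg continuous_snd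
  -- the hypotheses on the half-space
  have hmeas := aestronglyMeasurable_halfSpace_of_forall hw
  have hsym' : ∀ θ, ∀ᵐ z ∂(volume.restrict {z : ℝ × EuclideanSpace ℝ (Fin 3) | z.1 < 0}),
      A θ (uncurry w (z.1, rotZ θ z.2)) = uncurry w z := fun θ => by
    filter_upwards [ae_restrict_halfSpace_of_forall (hsym θ)] with z hz
    rw [hAapp, uncurry_apply_pair, hz, ← rotZ_add, neg_add_cancel, rotZ_zero]
    rfl
  obtain ⟨g, hg, hgw⟩ := exists_repr_of_ae_twistInvariant_of_aestronglyMeasurable A hA hAper hAc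
    measurePreserving_rotST_halfSpace hmeas hsym'
  refine ⟨curry g, fun s θ y => ?_, fun a ha => ?_⟩
  · have key := hg θ (s, y)
    rw [hAapp] at key
    -- apply `R_θ` to both sides
    have := congrArg (rotZ θ) key
    rwa [← rotZ_add, add_neg_cancel, rotZ_zero] at this
  · filter_upwards [ae_restrict_parabolicCylinder_of_halfSpace hgw a] with z hz
    rw [← hz]
    rfl

/-- **Pointwise axisymmetric representative of an a.e. rotation-invariant scalar** (the pressure
half of property (𝒜)(ii)). If `π : ℝ → ℝ³ → ℝ` is a.e. strongly measurable on every `Q(a)` and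
`π(s, R_θ y) = π(s, y)` for a.e. `(s, y) ∈ Q(a)`, every `θ` and `a > 0`, then there is `π'` with
every slice rotation invariant (`IsAxisymmetricScalar`) and `π' = π` a.e. on every `Q(a)`.
[cite: Seregin2020, proof of Thm 2.1, property (𝒜)(ii)] -/
theorem exists_isAxisymmetricScalar_repr {π : ℝ → EuclideanSpace ℝ (Fin 3) → ℝ}
    (hπ : ∀ a : ℝ, 0 < a → AEStronglyMeasurable (uncurry π)
      (volume.restrict (parabolicCylinder a (0 : ℝ × EuclideanSpace ℝ (Fin 3)))))
    (hsym : ∀ (θ a : ℝ), 0 < a →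
      ∀ᵐ z ∂(volume.restrict (parabolicCylinder a (0 : ℝ × EuclideanSpace ℝ (Fin 3)))),
        π z.1 (rotZ θ z.2) = π z.1 z.2) :
    ∃ π' : ℝ → EuclideanSpace ℝ (Fin 3) → ℝ,
      (∀ s, IsAxisymmetricScalar (π' s)) ∧
      ∀ a : ℝ, 0 < a →
        ∀ᵐ z ∂(volume.restrict (parabolicCylinder a (0 : ℝ × EuclideanSpace ℝ (Fin 3)))),
          uncurry π' z = uncurry π z := by
  set A : ℝ → ℝ →ₗᵢ[ℝ] ℝ := fun _ => LinearIsometry.id with hAdef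
  have hAc : Continuous fun p : ℝ × ℝ => A p.1 p.2 := continuous_snd
  have hmeas := aestronglyMeasurable_halfSpace_of_forall hπ
  have hsym' : ∀ θ, ∀ᵐ z ∂(volume.restrict {z : ℝ × EuclideanSpace ℝ (Fin 3) | z.1 < 0}),
      A θ (uncurry π (z.1, rotZ θ z.2)) = uncurry π z := fun θ => by
    filter_upwards [ae_restrict_halfSpace_of_forall (hsym θ)] with z hz
    exact hz
  obtain ⟨g, hg, hgπ⟩ := exists_repr_of_ae_twistInvariant_of_aestronglyMeasurable A
    (fun _ _ _ => rfl) (fun _ _ => rfl) hAc measurePreserving_rotST_halfSpace hmeas hsym'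
  refine ⟨curry g, fun s θ y => hg θ (s, y), fun a ha => ?_⟩
  filter_upwards [ae_restrict_parabolicCylinder_of_halfSpace hgπ a] with z hz
  rw [← hz]
  rfl

/-! ### The registered sub-stub -/

/-- **Sub-stub `stub_seregin2020TypeII_axisymRepr` of the crux `AxisymmetricKatoGlobal`**
(toward `stub_seregin2020TypeII`, Seregin 2020 Thm 2.1, property (𝒜)(ii)): the vector and the
scalar representative theorems of this file, conjoined.
[cite: Seregin2020, proof of Thm 2.1, property (𝒜)(ii)] -/
theorem stub_seregin2020TypeII_axisymRepr :
    (∀ (w : ℝ → EuclideanSpace ℝ (Fin 3) → EuclideanSpace ℝ (Fin 3)),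
      (∀ a : ℝ, 0 < a → AEStronglyMeasurable (uncurry w)
        (volume.restrict (parabolicCylinder a (0 : ℝ × EuclideanSpace ℝ (Fin 3))))) →
      (∀ (θ a : ℝ), 0 < a →
        ∀ᵐ z ∂(volume.restrict (parabolicCylinder a (0 : ℝ × EuclideanSpace ℝ (Fin 3)))),
          w z.1 (rotZ θ z.2) = rotZ θ (w z.1 z.2)) →
      ∃ w' : ℝ → EuclideanSpace ℝ (Fin 3) → EuclideanSpace ℝ (Fin 3),
        (∀ s, IsAxisymmetric (w' s)) ∧
        ∀ a : ℝ, 0 < a →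
          ∀ᵐ z ∂(volume.restrict (parabolicCylinder a (0 : ℝ × EuclideanSpace ℝ (Fin 3)))),
            uncurry w' z = uncurry w z) ∧
    (∀ (π : ℝ → EuclideanSpace ℝ (Fin 3) → ℝ),
      (∀ a : ℝ, 0 < a → AEStronglyMeasurable (uncurry π)
        (volume.restrict (parabolicCylinder a (0 : ℝ × EuclideanSpace ℝ (Fin 3))))) →
      (∀ (θ a : ℝ), 0 < a →
        ∀ᵐ z ∂(volume.restrict (parabolicCylinder a (0 : ℝ × EuclideanSpace ℝ (Fin 3)))),
          π z.1 (rotZ θ z.2) = π z.1 z.2) →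
      ∃ π' : ℝ → EuclideanSpace ℝ (Fin 3) → ℝ,
        (∀ s, IsAxisymmetricScalar (π' s)) ∧
        ∀ a : ℝ, 0 < a →
          ∀ᵐ z ∂(volume.restrict (parabolicCylinder a (0 : ℝ × EuclideanSpace ℝ (Fin 3)))),
            uncurry π' z = uncurry π z) :=
  ⟨fun _ hw hsym => exists_isAxisymmetric_repr hw hsym,
    fun _ hπ hsym => exists_isAxisymmetricScalar_repr hπ hsym⟩

end Summit.NavierStokesRegularity.NavierStokesRegularity.Theorems.AxisymmetricKatoGlobal.EulerScaling

end
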